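import Summits.Ventures.HodgeRepro.SquareCount
import Summits.Ventures.HodgeRepro.InvariantTypes
import Summits.Ventures.HodgeRepro.TwistOrbitSize

/-!
# Squares fixed by a twist: `Fix(g) = (m/2)·2^((m−2)/2)` for every finite `(G, c)` (seat `p1`, gen 5)

Blind re-derivation cell `pub-hodge-repro`.  Continues `SquareCount.lean` (the finset `squares c`) and
`InvariantTypes.lean` (`#invCMTypes = 2^(m/2)`).  Lemma 2 of `proofs/P1.md` §8, for every twist `g` and `|G| = 2m > 4`:

* `rmulSet_typeSquare` — twists of squares are squares of twisted faces, `Sq(Φ; p, p')·h = Sq(Φ·h; p h, p' h)`;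
  `rmulSet_mem_squares` — the squares are stable under the twists;
* `fixedSquares c g` — the squares fixed by `g`; `fixedSquares_one` (all of them) and `fixedSquares_eq_empty` (none,
  unless `g = 1` or `g` is an involution other than `c` — the stabiliser lemma of `TwistStabilizer.lean`);
* for an involution `g ∉ {1, c}`: `typeSquare_mem_fixedSquares` (the square of `(Ψ; p, p g)` of a `g`-invariant type
  `Ψ` is fixed), `exists_invCMType_typeSquare_eq` (every fixed square is of this form: it has a `g`-invariant corner),
  `card_fiber_fixedSquares` (every fixed square arises from exactly `8 = 2·4` pairs `(Ψ, p)`: its two `g`-invariant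
  corners times the four embeddings at its two places), hence
  **`card_fixedSquares_mul`** — `8·Fix(g) = #invCMTypes·|G|` — and **`card_fixedSquares`** — `4·Fix(g) = m·2^(m/2)`,
  i.e. `Fix(g) = (m/2)·2^((m−2)/2)` (`4` at `m = 4`, `12` at `m = 6`, the sealed `stabilized_count` tables).
-/

open Finset

namespace HodgeRepro.TwistOrbit

variable {G : Type*} [Group G] [DecidableEq G]

/-! ### Twists of squares -/

/-- Twists of squares are squares of twisted faces: `Sq(Φ; p, p')·h = Sq(Φ·h; p h, p' h)`. -/
theorem rmulSet_typeSquare (c : G) (Φ : Finset G) (p p' h : G) :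
    rmulSet (typeSquare c Φ p p') h = typeSquare c (rmul Φ h) (p * h) (p' * h) := by
  unfold rmulSet typeSquare
  rw [image_insert, image_insert, image_insert, image_singleton]
  simp only [rmul_flipAt]

/-- An involution `g ∉ {1, c}` moves every place: `p g ∉ {p, c p}`. -/
theorem mul_not_mem_place_of_ne {c : G} (hc : IsComplexConj c) {g : G} (hg1 : g ≠ 1) (hgc : g ≠ c) (p : G) :
    p * g ∉ place c p := by
  intro h
  rcases (mul_mem_place_self_iff hc).1 h with rfl | rfl
  · exact hg1 rfl
  · exact hgc rfl

/-- The opposite corner `Ψ^{(p p')}` differs from `Ψ`. -/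
theorem flipAt_flipAt_ne_self {c : G} (hc : IsComplexConj c) {p p' : G} (hpp' : p' ∉ place c p) (Ψ : Finset G) :
    flipAt c p' (flipAt c p Ψ) ≠ Ψ := by
  intro h
  have hp : p ∉ place c p' := fun e => hpp' ((mem_place_comm hc).1 e)
  have := congrArg (fun T => p ∈ T) h
  rw [eq_iff_iff, mem_flipAt_of_not_mem_place hp, mem_flipAt_self_iff] at this
  exact not_iff_not_self this.symm

variable [Fintype G]

/-- The squares are stable under the twists. -/
theorem rmulSet_mem_squares {c : G} {S : Finset (Finset G)} (hS : S ∈ squares c) (h : G) :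
    rmulSet S h ∈ squares c := by
  obtain ⟨Φ, p, p', hΦ, hpp', rfl⟩ := mem_squares.1 hS
  rw [rmulSet_typeSquare]
  refine typeSquare_mem_squares (hΦ.rmul h) ?_
  rwa [mul_mem_place_mul_iff]

/-! ### Fixed squares -/

/-- The squares fixed by the twist `g`. -/
def fixedSquares (c g : G) : Finset (Finset (Finset G)) := (squares c).filter fun S => rmulSet S g = S

/-- Membership in `fixedSquares`. -/
theorem mem_fixedSquares {c g : G} {S : Finset (Finset G)} :
    S ∈ fixedSquares c g ↔ S ∈ squares c ∧ rmulSet S g = S := by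
  simp [fixedSquares]

/-- The identity fixes every square. -/
theorem fixedSquares_one (c : G) : fixedSquares c 1 = squares c := by
  unfold fixedSquares
  refine filter_true_of_mem fun S _ => ?_
  rw [← mem_stabilizerSet]
  exact one_mem_stabilizerSet S

/-- A twist other than the identity and the involutions `≠ c` fixes no square (given a third place). -/
theorem fixedSquares_eq_empty {c : G} (hc : IsComplexConj c) (h4 : 4 < Fintype.card G) {g : G} (hg1 : g ≠ 1)
    (hg : ¬ (g * g = 1 ∧ g ≠ c)) : fixedSquares c g = ∅ := by
  rw [eq_empty_iff_forall_notMem]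
  intro S hS
  rw [mem_fixedSquares] at hS
  obtain ⟨Φ, p, p', hΦ, hpp', rfl⟩ := mem_squares.1 hS.1
  rcases eq_one_or_involution_of_fix hc hΦ hpp' (exists_third_place h4 p p') hS.2 with e | ⟨h1, h2, -, -⟩
  · exact hg1 e
  · exact hg ⟨h1, h2⟩

/-! ### Fixed squares of an involution `g ∉ {1, c}` -/

/-- The square of `(Ψ; p, p g)` of a `g`-invariant CM type `Ψ` is a square fixed by `g`. -/
theorem typeSquare_mem_fixedSquares {c : G} (hc : IsComplexConj c) {g : G} (hg : g * g = 1) (hg1 : g ≠ 1) (hgc : g ≠ c)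
    {Ψ : Finset G} (hΨ : IsCMType c Ψ) (hΨg : rmul Ψ g = Ψ) (p : G) :
    typeSquare c Ψ p (p * g) ∈ fixedSquares c g := by
  rw [mem_fixedSquares]
  refine ⟨typeSquare_mem_squares hΨ (mul_not_mem_place_of_ne hc hg1 hgc p), ?_⟩
  rw [rmulSet_typeSquare, hΨg, mul_assoc, hg, mul_one, typeSquare_comm]

/-- Every square fixed by an involution `g ∉ {1, c}` is the square of `(Ψ; p, p g)` for a `g`-invariant corner `Ψ`. -/
theorem exists_invCMType_typeSquare_eq {c : G} (hc : IsComplexConj c) (h4 : 4 < Fintype.card G) {g : G}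
    (hg1 : g ≠ 1) {S : Finset (Finset G)} (hS : S ∈ fixedSquares c g) :
    ∃ Ψ p, Ψ ∈ invCMTypes c g ∧ typeSquare c Ψ p (p * g) = S := by
  rw [mem_fixedSquares] at hS
  obtain ⟨Φ, p, p', hΦ, hpp', rfl⟩ := mem_squares.1 hS.1
  have hq := exists_third_place (c := c) h4 p p'
  obtain ⟨Ψ, hΨS, hΨg⟩ := exists_corner_rmul_eq_of_fix hc hΦ hpp' hq hS.2 hg1
  rcases eq_one_or_involution_of_fix hc hΦ hpp' hq hS.2 with e | ⟨-, -, hA, -⟩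
  · exact absurd e hg1
  refine ⟨Ψ, p, mem_invCMTypes.2 ⟨isCMType_of_mem_typeSquare hc hΦ hΨS, hΨg⟩, ?_⟩
  rw [← typeSquare_eq_of_mem hΨS]
  have e : ∀ T, flipAt c (p * g) T = flipAt c p' T := flipAt_congr (place_eq_of_mem hc hA)
  simp only [typeSquare, e]

/-- The `g`-invariant corners of a fixed square `Sq(Ψ; p, p g)`, `Ψ` `g`-invariant, are exactly `Ψ` and `Ψ^{(p, p g)}`. -/
theorem filter_typeSquare_rmul_eq {c : G} (hc : IsComplexConj c) (h4 : 4 < Fintype.card G) {g : G} (hg : g * g = 1)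
    (hg1 : g ≠ 1) (hgc : g ≠ c) {Ψ : Finset G} (hΨ : IsCMType c Ψ) (hΨg : rmul Ψ g = Ψ) (p : G) :
    ((typeSquare c Ψ p (p * g)).filter fun T => rmul T g = T) = {Ψ, flipAt c (p * g) (flipAt c p Ψ)} := by
  have hpp' := mul_not_mem_place_of_ne hc hg1 hgc p
  have hfix : rmulSet (typeSquare c Ψ p (p * g)) g = typeSquare c Ψ p (p * g) :=
    (mem_fixedSquares.1 (typeSquare_mem_fixedSquares hc hg hg1 hgc hΨ hΨg p)).2
  ext T
  rw [mem_filter, mem_insert, mem_singleton]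
  constructor
  · rintro ⟨hT, hTg⟩
    exact (rmul_eq_self_iff_of_fix hc hΨ hpp' (exists_third_place h4 p (p * g)) hfix hg1
      (self_mem_typeSquare c Ψ p (p * g)) hΨg hT).1 hTg
  · intro h
    have hT : T ∈ typeSquare c Ψ p (p * g) := by
      rcases h with h | h <;> rw [h]
      · exact self_mem_typeSquare c Ψ p (p * g)
      · simp [typeSquare]
    exact ⟨hT, (rmul_eq_self_iff_of_fix hc hΨ hpp' (exists_third_place h4 p (p * g)) hfix hg1
      (self_mem_typeSquare c Ψ p (p * g)) hΨg hT).2 h⟩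

/-- The pairs `(Ψ, p)` with square `Sq(Ψ₀; p₀, p₀ g)`: a `g`-invariant corner and an embedding at one of the two places. -/
theorem filter_invCMTypes_typeSquare_eq {c : G} (hc : IsComplexConj c) {g : G} (hg : g * g = 1) (hg1 : g ≠ 1)
    (hgc : g ≠ c) {Ψ₀ : Finset G} (hΨ₀ : IsCMType c Ψ₀) (p₀ : G) :
    ((invCMTypes c g ×ˢ univ).filter fun x : Finset G × G => typeSquare c x.1 x.2 (x.2 * g) =
        typeSquare c Ψ₀ p₀ (p₀ * g)) =
      ((typeSquare c Ψ₀ p₀ (p₀ * g)).filter fun T => rmul T g = T) ×ˢ (place c p₀ ∪ place c (p₀ * g)) := by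
  ext ⟨Ψ, p⟩
  simp only [mem_filter, mem_product, mem_univ, and_true, mem_invCMTypes, mem_union]
  have hpp := mul_not_mem_place_of_ne hc hg1 hgc p
  rw [typeSquare_eq_iff hc hpp]
  constructor
  · rintro ⟨⟨-, hΨg⟩, hΨS, h⟩
    refine ⟨⟨hΨS, hΨg⟩, ?_⟩
    rcases h with ⟨h, -⟩ | ⟨h, -⟩
    · exact Or.inl h
    · exact Or.inr h
  · rintro ⟨⟨hΨS, hΨg⟩, h⟩
    refine ⟨⟨isCMType_of_mem_typeSquare hc hΨ₀ hΨS, hΨg⟩, hΨS, ?_⟩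
    rcases h with h | h
    · exact Or.inl ⟨h, mul_mem_place_mul_iff.2 h⟩
    · refine Or.inr ⟨h, ?_⟩
      have := mul_mem_place_mul_iff (c := c) (h := g) |>.2 h
      rwa [mul_assoc, hg, mul_one] at this

/-- **Every fixed square arises from exactly `8` pairs** `(Ψ, p)` with `Ψ` a `g`-invariant CM type: its two
`g`-invariant corners times the four embeddings at its two places. -/
theorem card_fiber_fixedSquares {c : G} (hc : IsComplexConj c) (h4 : 4 < Fintype.card G) {g : G} (hg : g * g = 1)
    (hg1 : g ≠ 1) (hgc : g ≠ c) {Ψ₀ : Finset G} (hΨ₀ : IsCMType c Ψ₀) (hΨ₀g : rmul Ψ₀ g = Ψ₀) (p₀ : G) :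
    ((invCMTypes c g ×ˢ univ).filter fun x : Finset G × G => typeSquare c x.1 x.2 (x.2 * g) =
        typeSquare c Ψ₀ p₀ (p₀ * g)).card = 8 := by
  rw [filter_invCMTypes_typeSquare_eq hc hg hg1 hgc hΨ₀ p₀, card_product,
    filter_typeSquare_rmul_eq hc h4 hg hg1 hgc hΨ₀ hΨ₀g p₀]
  have hpp' := mul_not_mem_place_of_ne hc hg1 hgc p₀
  rw [card_pair (flipAt_flipAt_ne_self hc hpp' Ψ₀).symm, card_union_of_disjoint (disjoint_place hc hpp'),
    card_place hc, card_place hc]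

/-- **`8·Fix(g) = #invCMTypes·|G|`** for an involution `g ∉ {1, c}` (double counting the pairs `(Ψ, p)`). -/
theorem card_fixedSquares_mul {c : G} (hc : IsComplexConj c) (h4 : 4 < Fintype.card G) {g : G} (hg : g * g = 1)
    (hg1 : g ≠ 1) (hgc : g ≠ c) : 8 * (fixedSquares c g).card = (invCMTypes c g).card * Fintype.card G := by
  have himage : (invCMTypes c g ×ˢ univ).image (fun x : Finset G × G => typeSquare c x.1 x.2 (x.2 * g)) =
      fixedSquares c g := by
    ext S
    rw [mem_image]
    constructor
    · rintro ⟨⟨Ψ, p⟩, hx, rfl⟩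
      rw [mem_product, mem_invCMTypes] at hx
      exact typeSquare_mem_fixedSquares hc hg hg1 hgc hx.1.1 hx.1.2 p
    · intro hS
      obtain ⟨Ψ, p, hΨ, rfl⟩ := exists_invCMType_typeSquare_eq hc h4 hg1 hS
      exact ⟨(Ψ, p), by rw [mem_product]; exact ⟨hΨ, mem_univ _⟩, rfl⟩
  rw [← card_univ, ← card_product, card_eq_sum_card_image
    (fun x : Finset G × G => typeSquare c x.1 x.2 (x.2 * g)), himage]
  rw [sum_congr rfl (g := fun _ => 8), sum_const, smul_eq_mul, mul_comm]
  intro S hS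
  obtain ⟨Ψ, p, hΨ, rfl⟩ := exists_invCMType_typeSquare_eq hc h4 hg1 hS
  rw [mem_invCMTypes] at hΨ
  exact card_fiber_fixedSquares hc h4 hg hg1 hgc hΨ.1 hΨ.2 p

/-- **`4·Fix(g) = m·2^(m/2)`**, `m = |G|/2`, for every involution `g ∉ {1, c}` (given `|G| > 4`): the number of squares
fixed by `g` is `(m/2)·2^((m−2)/2)`. -/
theorem card_fixedSquares {c : G} (hc : IsComplexConj c) (h4 : 4 < Fintype.card G) {g : G} (hg : g * g = 1)
    (hg1 : g ≠ 1) (hgc : g ≠ c) :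
    4 * (fixedSquares c g).card = (Fintype.card G / 2) * 2 ^ (Fintype.card G / 2 / 2) := by
  have h8 := card_fixedSquares_mul hc h4 hg hg1 hgc
  have hn := card_eq_two_mul_half hc
  rw [card_invCMTypes hc hg hg1 hgc] at h8
  set m := Fintype.card G / 2 with hm
  rw [hn] at h8
  have : 2 * (4 * (fixedSquares c g).card) = 2 * (m * 2 ^ (m / 2)) := by
    rw [← mul_assoc, show 2 * 4 = 8 by norm_num, h8]; ring
  exact Nat.eq_of_mul_eq_mul_left (by norm_num) this

end HodgeRepro.TwistOrbit
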